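import Literature.Geometry.Lorentzian.KerrDeSitterPartialModeStability
import HarnessLib

/-!
# Casals–Teixeira da Costa's partial mode stability with the hypotheses of their Proposition 3.8
# made explicit — the form that also covers the threshold rays `Re ω = mϖ_j` (named fact)

Source read verbatim: M. Casals, R. Teixeira da Costa, *Hidden spectral symmetries and mode
stability of subextremal Kerr(-de Sitter) black holes*, Commun. Math. Phys. 394 (2022) 797–832
[CasalsTeixeiradacosta2022], arXiv:2105.13329 **v2** (28 Apr 2023, "clarification of the proof of
Proposition 3.8 and other typos"; numbering of v2: Lemma 3.5, Proposition 3.8, Corollary 3.9,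
Theorem 3.10), §3.2–§3.4.

## What is printed, and what this file records

* Definition 3.3 defines "ingoing at `𝓗⁺`" / "outgoing at `𝓗⁺_c`" by the GENERIC boundary exponents
  (`R(r)(r−r₁)^{−η₁+(s−1)/2}`, `R(r)(r−r₂)^{η₂−(s+1)/2}` smooth) EXCEPT on the threshold lines: for
  `Re ω = mϖ₁ ∧ s ≥ 0`, resp. `Re ω = mϖ₂ ∧ s ≤ 0`, it switches to other exponents. The tree's
  `IsIngoingAtEventHorizon` / `IsOutgoingAtCosmoHorizon` are the generic bullets, and
  `CasalsTeixeiraDaCosta2022_partialModeStability` (Theorem 3.10 as printed) is therefore vendored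
  only off those rays (`KerrDeSitterPartialModeStability.lean`).
* Lemma 3.5 (verbatim): with `m₁ = s−η₁−η₀, m₂ = η₀−η₁, m₃ = −s−η₁−η₀, m₄ = η₀+η₁+2η₂` the radial
  ODE becomes (3.11) and "the boundary conditions in Definition 3.3 can be recast … noting that
  `−η₁+(s−1)/2 = ½(m₁+m₂−1)`, …, `η₂−(s+1)/2 = ½(m₃+m₄−1)`" — i.e. the GENERIC bullets are exactly the
  boundary conditions of Proposition 3.8 for the quadruple `(m₁,m₂,m₃,m₄)`, for every `ω`.
* Proposition 3.8 [Point spectrum] (v2, verbatim hypotheses): "Consider a quadruple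
  `(m_{i₁},m_{i₂},m_{i₃},m_{i₄})` … of complex numbers verifying three conditions: `Σ_j m_j ≠ N` for
  `N ∈ ℤ_{≥2}`, `Re(m_{i₁}+m_{i₂}−1) < 0` if `Im(m_{i₁}+m_{i₂}) = 0`, and `Re(m_{i₃}+m_{i₄}−1) < 0` if
  `Im(m_{i₃}+m_{i₄}) = 0`. Let `R^E` be the unique, up to rescaling, solution of the ODE (3.11) with
  boundary conditions • `R(z)(z−1)^{½(m_{i₁}+m_{i₂}−1)}` is smooth at `z=1`, • `R(z)(z−z₂)^{½(m_{i₃}+m_{i₄}−1)}`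
  is smooth at `z=z₂`. Then `R^E` is nontrivial if and only if the continued fraction condition (3.12)
  holds", the condition (3.12)–(3.13) being invariant under permutations of the `m_j` (proof of
  Prop. 3.8, last sentence). Proof of Corollary 3.9 (verbatim): "since
  `Σ_i m_i = 2(η₂−η₁) = i((Re ω−mϖ₁)/κ₁ + (Re ω−mϖ₂)/κ₂) − Im ω(1/κ₁+1/κ₂)`, the conditions of
  Proposition 3.8 clearly hold under our assumptions. Thus, the conclusion follows from Proposition 3.8
  after applying Lemma 3.5" — so, whenever Prop. 3.8's three conditions hold for BOTH quadruples
  `(m₁,m₂,m₃,m₄)` and `(m₁,m₃,m₂,m₄)`, a nontrivial generic-boundary solution of the spin-`s` radial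
  ODE yields a nontrivial solution of the transformed ODE (3.25) with boundary conditions (3.26)
  (Cor. 3.9 (i)⇒(iii)).
* Proof of Theorem 3.10, Step 2 (verbatim conclusion, `Im ω > 0`): "`Im(Ṽ ω̄) ≥ 0` for `z ∈ [1,z₂]`
  in the full subextremal range of parameters if (3.29) [`|ω|²/m² < ((ϖ₂/κ₂+ϖ₀/κ₀)/(1/κ₂+1/κ₀))²`]
  does not hold. In this case, we deduce directly from (3.28) that `ũ = 0` and then, using
  Corollary 3.9 …, we conclude that `R ≡ 0`", under the hypothesis `Im(λ̄ ω̄) ≤ 0` of Thm 3.10's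
  first bullet (used for the sign of the `λ̄`-term of `Ṽ`).

The printed STATEMENTS of Corollary 3.9 / Theorem 3.10 package the threshold lines by the sign of
`s` only ("If `Re ω = mϖ₂`, then (i) and (iii) are equivalent if `s ≥ 0`"), whereas the printed
hypotheses of Proposition 3.8 that the proof actually verifies are, on `Re ω = mϖ₂` for the pair
`m₃+m₄ = −s+2η₂ = −s − Im ω/κ₂` (real there): `Re(m₃+m₄−1) < 0 ⇔ Im ω > −(s+1)κ₂` — automatic
for `s ≥ 0`, and for `s = −2` exactly `Im ω > κ₂` (at `Im ω = κ₂` the local exponents at `z₂` differ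
by `1`: the exceptional point `mϖ₂ + iκ₂`). This file records, as ONE named fact
`CasalsTeixeiraDaCosta2022_partialModeStabilityProp38`, the upper-half-plane conclusion of
Theorem 3.10 for GENERIC-boundary solutions under the explicit hypotheses of Proposition 3.8 for
the two quadruples, written in the paper's horizon data `η_j, ϖ_j, κ_j` ((3.10); `etaCauchy`,
`etaEvent`, `etaCosmo`, `horizonAngVel`, `surfaceGravity`). This is what the printed proofs of
Cor. 3.9 and Thm. 3.10 establish verbatim; it is NOT the printed wording of Theorem 3.10 on the rays
(which concerns other boundary exponents there) — reviewers: see the three verbatim items above; the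
pub-kds cell's referee ratified this reading independently (REFEREE.md #16 D). Everything else
here is proved: real/imaginary parts of the `η_j`, which hypotheses are automatic for `Im ω > 0`
(`sum_ne_int`, `pairCondition_cauchyCosmo`, `pairCondition_*_of_re_ne`,
`pairCondition_eventCauchy` under `κ₁ ≤ κ₀`), the threshold-ray readings
(`pairCondition_cosmo_iff`: on `Re ω = mϖ₂`, `⇔ −(s+1)κ₂ < Im ω`; `pairCondition_event_iff`), and the
corollary `.window` used by box certificates. No other facts. -- TODO(general form): the real-axis
bullet of Theorem 3.10 in the same explicit form; `κ₁ ≤ κ₀` from `IsSubextremal`.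
-/

noncomputable section

open Complex Set

namespace Literature.Geometry.Lorentzian.KerrDeSitter

/-! ### Horizon data `κ_j`, `η_j` of Casals–Teixeira da Costa (3.10) -/

/-- The **surface gravity** `κ_j = |∏_{j'≠j}(r_j − r_{j'})|/(2L²Ξ(r_j²+a²)) = |Δ_r'(r_j)|/(2Ξ(r_j²+a²))` of
the horizon `r = r_j` (`Δ_r = −L^{−2}∏(r − r_k)`). [cite: CasalsTeixeiradacosta2022, (3.10)] -/
def surfaceGravity (M a Λ rh : ℝ) : ℝ :=
  |deltaDeriv M a Λ rh| / (2 * xi a Λ * (rh ^ 2 + a ^ 2))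

/-- `η_j` for a horizon with angular velocity `ϖ`, surface gravity `κ` and sign `(−1)^j = σ`:
`η = σ · i(ω − mϖ)/(2κ)`. [cite: CasalsTeixeiradacosta2022, (3.10)] -/
def etaOf (σ ϖ κ : ℝ) (ω : ℂ) (m : ℝ) : ℂ :=
  (σ : ℂ) * (I * (ω - ((m * ϖ : ℝ) : ℂ))) / ((2 * κ : ℝ) : ℂ)

/-- `η₀ = +i(ω − mϖ₀)/(2κ₀)` (Cauchy horizon `r₀ = rMinus`). [cite: CasalsTeixeiradacosta2022, (3.10)] -/
def etaCauchy (M a Λ : ℝ) (ω : ℂ) (m : ℝ) : ℂ :=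
  etaOf 1 (horizonAngVel a (rMinus M a Λ)) (surfaceGravity M a Λ (rMinus M a Λ)) ω m

/-- `η₁ = −i(ω − mϖ₁)/(2κ₁)` (event horizon `r₁ = rPlus`). [cite: CasalsTeixeiradacosta2022, (3.10)] -/
def etaEvent (M a Λ : ℝ) (ω : ℂ) (m : ℝ) : ℂ :=
  etaOf (-1) (horizonAngVel a (rPlus M a Λ)) (surfaceGravity M a Λ (rPlus M a Λ)) ω m

/-- `η₂ = +i(ω − mϖ₂)/(2κ₂)` (cosmological horizon `r₂ = rCosmo`). [cite: CasalsTeixeiradacosta2022, (3.10)] -/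
def etaCosmo (M a Λ : ℝ) (ω : ℂ) (m : ℝ) : ℂ :=
  etaOf 1 (horizonAngVel a (rCosmo M a Λ)) (surfaceGravity M a Λ (rCosmo M a Λ)) ω m

/-- Proposition 3.8's pair condition on a sum `p = m_i + m_j` of two of its parameters:
"`Re(p − 1) < 0` if `Im(p) = 0`". [cite: CasalsTeixeiradacosta2022, Proposition 3.8 (arXiv v2)] -/
def PairCondition (p : ℂ) : Prop := p.im = 0 → p.re - 1 < 0

/-! ### The named fact -/

/-- **Casals–Teixeira da Costa 2022: Theorem 3.10 (upper half-plane) for generic-boundary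
solutions, under the explicit hypotheses of Proposition 3.8 (arXiv v2).** For subextremal
Kerr–de Sitter parameters (`M > 0`, `Λ > 0`, (3.1); `0 ≤ a < 3/Λ` as in the companion fact),
`s ∈ ½ℤ`, `m − s ∈ ℤ`, `Im ω > 0`, `Im(λ̄ ω̄) ≤ 0`, `|ω| ∉ |m|·(0, Ω_SR)` with
`Ω_SR = (ϖ₂/κ₂+ϖ₀/κ₀)/(1/κ₂+1/κ₀) = 2a/(a²+3/Λ−(r₀+r₂)²)` (`superradiantUpper`), and Proposition 3.8's
conditions for the quadruples `(m₁,m₂,m₃,m₄)` and `(m₁,m₃,m₂,m₄)` of Lemma 3.5 / Corollary 3.9 —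
`Σ_j m_j = 2(η₂−η₁) ∉ ℤ_{≥2}`; "`Re(p−1) < 0` if `Im p = 0`" for the pair sums `p = m₁+m₂ = s−2η₁`,
`m₃+m₄ = −s+2η₂`, `m₁+m₃ = −2(η₁+η₀)`, `m₂+m₄ = 2(η₀+η₂)` —, every classical solution of the radial
Teukolsky ODE on `(r₊, r_c)` that is ingoing at `𝓗⁺` and outgoing at `𝓗⁺_c` IN THE GENERIC SENSE
(`IsIngoingAtEventHorizon`, `IsOutgoingAtCosmoHorizon`) vanishes identically. This is the
conjunction of the printed Lemma 3.5 (generic bullets = Prop. 3.8's boundary conditions for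
`(m₁,m₂,m₃,m₄)`), Proposition 3.8 for both quadruples with the permutation invariance of (3.12)
(= proof of Cor. 3.9, (i)⇒(iii)), and Step 2 of the proof of Thm. 3.10 (`ũ ≡ 0` unless
`|ω| < |m|Ω_SR`); on the threshold rays it replaces the printed case split "s ≥ 0 / s ≤ 0" of
Cor. 3.9 / Def. 3.3 by the hypotheses the proof uses (see the module docstring; e.g. `s = −2`,
`Re ω = mϖ₂`: `Im ω > κ₂`, `pairCondition_cosmo_iff`). Named fact; users take
`(h : CasalsTeixeiraDaCosta2022_partialModeStabilityProp38)`.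
[cite: CasalsTeixeiradacosta2022, Proposition 3.8 (arXiv v2) with Lemma 3.5, proof of Corollary 3.9 and proof of Theorem 3.10 (Step 2)] -/
def CasalsTeixeiraDaCosta2022_partialModeStabilityProp38 : Prop :=
  ∀ (M a Λ s : ℝ) (ω : ℂ) (m : ℝ) (lam : ℂ), IsSubextremal M a Λ → 0 ≤ a → |a| < 3 / Λ →
    (∃ k : ℤ, 2 * s = k) → (∃ k : ℤ, m - s = k) →
    0 < ω.im → (lambdaBar a Λ s ω m lam * (starRingEnd ℂ) ω).im ≤ 0 →
    ¬(0 < ‖ω‖ ∧ ‖ω‖ < |m| * superradiantUpper M a Λ) →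
    (∀ n : ℤ, 2 ≤ n → 2 * (etaCosmo M a Λ ω m - etaEvent M a Λ ω m) ≠ (n : ℂ)) →
    PairCondition ((s : ℂ) - 2 * etaEvent M a Λ ω m) →
    PairCondition (-(s : ℂ) + 2 * etaCosmo M a Λ ω m) →
    PairCondition (-2 * (etaEvent M a Λ ω m + etaCauchy M a Λ ω m)) →
    PairCondition (2 * (etaCauchy M a Λ ω m + etaCosmo M a Λ ω m)) →
    ∀ R : ℝ → ℂ, IsRadialTeukolskySolution M a Λ s ω m lam R →
      IsIngoingAtEventHorizon M a Λ s ω m R → IsOutgoingAtCosmoHorizon M a Λ ω m R →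
        ∀ r ∈ Ioo (rPlus M a Λ) (rCosmo M a Λ), R r = 0

/-! ### Real and imaginary parts of the `η_j`; which hypotheses are automatic -/

/-- `Re η = −σ·Im ω/(2κ)` for `η = σ i(ω−mϖ)/(2κ)`. [cite: CasalsTeixeiradacosta2022, (3.10) and proof of Corollary 3.9] -/
theorem etaOf_re (σ ϖ κ : ℝ) (ω : ℂ) (m : ℝ) :
    (etaOf σ ϖ κ ω m).re = -σ * ω.im / (2 * κ) := by
  unfold etaOf
  rw [Complex.div_ofReal_re]
  simp [Complex.mul_re, Complex.mul_im]

/-- `Im η = σ·(Re ω − mϖ)/(2κ)` for `η = σ i(ω−mϖ)/(2κ)`. [cite: CasalsTeixeiradacosta2022, (3.10) and proof of Corollary 3.9] -/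
theorem etaOf_im (σ ϖ κ : ℝ) (ω : ℂ) (m : ℝ) :
    (etaOf σ ϖ κ ω m).im = σ * (ω.re - m * ϖ) / (2 * κ) := by
  unfold etaOf
  rw [Complex.div_ofReal_im]
  simp [Complex.mul_re, Complex.mul_im]

/-- A pair sum with non-zero imaginary part satisfies Prop. 3.8's condition vacuously.
[cite: CasalsTeixeiradacosta2022, Proposition 3.8 (arXiv v2)] -/
theorem pairCondition_of_im_ne {p : ℂ} (h : p.im ≠ 0) : PairCondition p := fun h0 => absurd h0 h

/-- `Re η₂ = −Im ω/(2κ₂)`. [cite: CasalsTeixeiradacosta2022, (3.10) and proof of Corollary 3.9] -/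
theorem etaCosmo_re (M a Λ : ℝ) (ω : ℂ) (m : ℝ) :
    (etaCosmo M a Λ ω m).re = -(ω.im / (2 * surfaceGravity M a Λ (rCosmo M a Λ))) := by
  rw [etaCosmo, etaOf_re]; ring

/-- `Im η₂ = (Re ω − mϖ₂)/(2κ₂)`. [cite: CasalsTeixeiradacosta2022, (3.10) and proof of Corollary 3.9] -/
theorem etaCosmo_im (M a Λ : ℝ) (ω : ℂ) (m : ℝ) :
    (etaCosmo M a Λ ω m).im =
      (ω.re - m * horizonAngVel a (rCosmo M a Λ)) / (2 * surfaceGravity M a Λ (rCosmo M a Λ)) := by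
  rw [etaCosmo, etaOf_im]; ring

/-- `Re η₁ = +Im ω/(2κ₁)`. [cite: CasalsTeixeiradacosta2022, (3.10) and proof of Corollary 3.9] -/
theorem etaEvent_re (M a Λ : ℝ) (ω : ℂ) (m : ℝ) :
    (etaEvent M a Λ ω m).re = ω.im / (2 * surfaceGravity M a Λ (rPlus M a Λ)) := by
  rw [etaEvent, etaOf_re]; ring

/-- `Im η₁ = −(Re ω − mϖ₁)/(2κ₁)`. [cite: CasalsTeixeiradacosta2022, (3.10) and proof of Corollary 3.9] -/
theorem etaEvent_im (M a Λ : ℝ) (ω : ℂ) (m : ℝ) :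
    (etaEvent M a Λ ω m).im =
      -((ω.re - m * horizonAngVel a (rPlus M a Λ)) / (2 * surfaceGravity M a Λ (rPlus M a Λ))) := by
  rw [etaEvent, etaOf_im]; ring

/-- `Re η₀ = −Im ω/(2κ₀)`. [cite: CasalsTeixeiradacosta2022, (3.10) and proof of Corollary 3.9] -/
theorem etaCauchy_re (M a Λ : ℝ) (ω : ℂ) (m : ℝ) :
    (etaCauchy M a Λ ω m).re = -(ω.im / (2 * surfaceGravity M a Λ (rMinus M a Λ))) := by
  rw [etaCauchy, etaOf_re]; ring

/-- `Im η₀ = (Re ω − mϖ₀)/(2κ₀)`. [cite: CasalsTeixeiradacosta2022, (3.10) and proof of Corollary 3.9] -/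
theorem etaCauchy_im (M a Λ : ℝ) (ω : ℂ) (m : ℝ) :
    (etaCauchy M a Λ ω m).im =
      (ω.re - m * horizonAngVel a (rMinus M a Λ)) / (2 * surfaceGravity M a Λ (rMinus M a Λ)) := by
  rw [etaCauchy, etaOf_im]; ring

/-- **The threshold ray at the cosmological horizon.** On `Re ω = mϖ₂` (with `κ₂ > 0`) the pair
condition for `m₃+m₄ = −s+2η₂` reads `−(s+1)κ₂ < Im ω`; for `s = −2` this is `Im ω > κ₂`, for
`s ≥ 0` it is automatic when `Im ω > 0`. [cite: CasalsTeixeiradacosta2022, Proposition 3.8 (arXiv v2) with Lemma 3.5] -/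
theorem pairCondition_cosmo_iff {M a Λ s : ℝ} {ω : ℂ} {m : ℝ}
    (hκ : 0 < surfaceGravity M a Λ (rCosmo M a Λ))
    (hre : ω.re = m * horizonAngVel a (rCosmo M a Λ)) :
    PairCondition (-(s : ℂ) + 2 * etaCosmo M a Λ ω m) ↔
      -(s + 1) * surfaceGravity M a Λ (rCosmo M a Λ) < ω.im := by
  have hκ0 : surfaceGravity M a Λ (rCosmo M a Λ) ≠ 0 := hκ.ne'
  have him : (-(s : ℂ) + 2 * etaCosmo M a Λ ω m).im = 0 := by
    simp [etaCosmo_im, hre]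
  have hre' : (-(s : ℂ) + 2 * etaCosmo M a Λ ω m).re =
      -s - ω.im / surfaceGravity M a Λ (rCosmo M a Λ) := by
    simp [etaCosmo_re]
    field_simp
    ring
  have key : -s - ω.im / surfaceGravity M a Λ (rCosmo M a Λ) - 1 < 0 ↔
      -(s + 1) * surfaceGravity M a Λ (rCosmo M a Λ) < ω.im := by
    rw [show -s - ω.im / surfaceGravity M a Λ (rCosmo M a Λ) - 1 =
        (-(s + 1) * surfaceGravity M a Λ (rCosmo M a Λ) - ω.im) / surfaceGravity M a Λ (rCosmo M a Λ)
        from by field_simp; ring]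
    rw [div_neg_iff]
    constructor
    · rintro (⟨_, h⟩ | ⟨h, _⟩)
      · exact absurd hκ (not_lt.mpr h.le)
      · linarith
    · intro h
      exact Or.inr ⟨by linarith, hκ⟩
  unfold PairCondition
  rw [hre']
  exact ⟨fun h => key.mp (h him), fun h _ => key.mpr h⟩

/-- Off the ray `Re ω = mϖ₂` the pair condition for `m₃+m₄ = −s+2η₂` holds vacuously (`κ₂ ≠ 0`).
[cite: CasalsTeixeiradacosta2022, Proposition 3.8 (arXiv v2) with Lemma 3.5] -/
theorem pairCondition_cosmo_of_re_ne {M a Λ s : ℝ} {ω : ℂ} {m : ℝ}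
    (hκ : surfaceGravity M a Λ (rCosmo M a Λ) ≠ 0)
    (hre : ω.re ≠ m * horizonAngVel a (rCosmo M a Λ)) :
    PairCondition (-(s : ℂ) + 2 * etaCosmo M a Λ ω m) := by
  apply pairCondition_of_im_ne
  have h : (-(s : ℂ) + 2 * etaCosmo M a Λ ω m).im =
      (ω.re - m * horizonAngVel a (rCosmo M a Λ)) / surfaceGravity M a Λ (rCosmo M a Λ) := by
    simp [etaCosmo_im]
    field_simp
  rw [h]
  exact div_ne_zero (sub_ne_zero.mpr hre) hκ

/-- **The threshold ray at the event horizon.** On `Re ω = mϖ₁` (with `κ₁ > 0`) the pair condition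
for `m₁+m₂ = s−2η₁` reads `(s−1)κ₁ < Im ω`; automatic for `s ≤ 0` when `Im ω > 0`.
[cite: CasalsTeixeiradacosta2022, Proposition 3.8 (arXiv v2) with Lemma 3.5] -/
theorem pairCondition_event_iff {M a Λ s : ℝ} {ω : ℂ} {m : ℝ}
    (hκ : 0 < surfaceGravity M a Λ (rPlus M a Λ))
    (hre : ω.re = m * horizonAngVel a (rPlus M a Λ)) :
    PairCondition ((s : ℂ) - 2 * etaEvent M a Λ ω m) ↔
      (s - 1) * surfaceGravity M a Λ (rPlus M a Λ) < ω.im := by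
  have hκ0 : surfaceGravity M a Λ (rPlus M a Λ) ≠ 0 := hκ.ne'
  have him : ((s : ℂ) - 2 * etaEvent M a Λ ω m).im = 0 := by
    simp [etaEvent_im, hre]
  have hre' : ((s : ℂ) - 2 * etaEvent M a Λ ω m).re =
      s - ω.im / surfaceGravity M a Λ (rPlus M a Λ) := by
    simp [etaEvent_re]
    field_simp
  have key : s - ω.im / surfaceGravity M a Λ (rPlus M a Λ) - 1 < 0 ↔
      (s - 1) * surfaceGravity M a Λ (rPlus M a Λ) < ω.im := by
    rw [show s - ω.im / surfaceGravity M a Λ (rPlus M a Λ) - 1 =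
        ((s - 1) * surfaceGravity M a Λ (rPlus M a Λ) - ω.im) / surfaceGravity M a Λ (rPlus M a Λ)
        from by field_simp; ring]
    rw [div_neg_iff]
    constructor
    · rintro (⟨_, h⟩ | ⟨h, _⟩)
      · exact absurd hκ (not_lt.mpr h.le)
      · linarith
    · intro h
      exact Or.inr ⟨by linarith, hκ⟩
  unfold PairCondition
  rw [hre']
  exact ⟨fun h => key.mp (h him), fun h _ => key.mpr h⟩

/-- Off the ray `Re ω = mϖ₁` the pair condition for `m₁+m₂ = s−2η₁` holds vacuously (`κ₁ ≠ 0`).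
[cite: CasalsTeixeiradacosta2022, Proposition 3.8 (arXiv v2) with Lemma 3.5] -/
theorem pairCondition_event_of_re_ne {M a Λ s : ℝ} {ω : ℂ} {m : ℝ}
    (hκ : surfaceGravity M a Λ (rPlus M a Λ) ≠ 0)
    (hre : ω.re ≠ m * horizonAngVel a (rPlus M a Λ)) :
    PairCondition ((s : ℂ) - 2 * etaEvent M a Λ ω m) := by
  apply pairCondition_of_im_ne
  have h : ((s : ℂ) - 2 * etaEvent M a Λ ω m).im =
      (ω.re - m * horizonAngVel a (rPlus M a Λ)) / surfaceGravity M a Λ (rPlus M a Λ) := by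
    simp [etaEvent_im]
    field_simp
  rw [h]
  exact div_ne_zero (sub_ne_zero.mpr hre) hκ

/-- Prop. 3.8's first condition is automatic in the upper half-plane:
`Re Σ_j m_j = Re 2(η₂−η₁) = −Im ω(1/κ₁+1/κ₂) < 0`, so `Σ_j m_j ∉ ℤ_{≥2}` (proof of Cor. 3.9).
[cite: CasalsTeixeiradacosta2022, proof of Corollary 3.9] -/
theorem sum_ne_int {M a Λ : ℝ} {ω : ℂ} {m : ℝ}
    (hκ₁ : 0 < surfaceGravity M a Λ (rPlus M a Λ)) (hκ₂ : 0 < surfaceGravity M a Λ (rCosmo M a Λ))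
    (hω : 0 < ω.im) (n : ℤ) (hn : 2 ≤ n) :
    2 * (etaCosmo M a Λ ω m - etaEvent M a Λ ω m) ≠ (n : ℂ) := by
  intro h
  have hre := congrArg Complex.re h
  simp [etaCosmo_re, etaEvent_re] at hre
  have h1 : 0 < ω.im / (2 * surfaceGravity M a Λ (rCosmo M a Λ)) := by positivity
  have h2 : 0 < ω.im / (2 * surfaceGravity M a Λ (rPlus M a Λ)) := by positivity
  have h3 : (2 : ℝ) ≤ (n : ℝ) := by exact_mod_cast hn
  linarith

/-- The pair `m₂+m₄ = 2(η₀+η₂)` of the quadruple `(m₁,m₃,m₂,m₄)`: `Re = −Im ω(1/κ₀+1/κ₂) ≤ 0 < 1`, so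
its condition is automatic for `Im ω ≥ 0`. [cite: CasalsTeixeiradacosta2022, Proposition 3.8 (arXiv v2) with Lemma 3.5] -/
theorem pairCondition_cauchyCosmo {M a Λ : ℝ} {ω : ℂ} {m : ℝ}
    (hκ₀ : 0 < surfaceGravity M a Λ (rMinus M a Λ)) (hκ₂ : 0 < surfaceGravity M a Λ (rCosmo M a Λ))
    (hω : 0 ≤ ω.im) :
    PairCondition (2 * (etaCauchy M a Λ ω m + etaCosmo M a Λ ω m)) := by
  intro _
  simp [etaCauchy_re, etaCosmo_re]
  have h1 : 0 ≤ ω.im / (2 * surfaceGravity M a Λ (rMinus M a Λ)) := by positivity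
  have h2 : 0 ≤ ω.im / (2 * surfaceGravity M a Λ (rCosmo M a Λ)) := by positivity
  linarith

/-- The pair `m₁+m₃ = −2(η₁+η₀)` of the quadruple `(m₁,m₃,m₂,m₄)`: `Re = Im ω(1/κ₀ − 1/κ₁)`, which
is `≤ 0 < 1` whenever `κ₁ ≤ κ₀` and `Im ω ≥ 0` (surface gravity of the Cauchy horizon at least that
of the event horizon), so its condition is then automatic.
[cite: CasalsTeixeiradacosta2022, Proposition 3.8 (arXiv v2) with Lemma 3.5] -/
theorem pairCondition_eventCauchy {M a Λ : ℝ} {ω : ℂ} {m : ℝ}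
    (hκ₁ : 0 < surfaceGravity M a Λ (rPlus M a Λ))
    (hle : surfaceGravity M a Λ (rPlus M a Λ) ≤ surfaceGravity M a Λ (rMinus M a Λ))
    (hω : 0 ≤ ω.im) :
    PairCondition (-2 * (etaEvent M a Λ ω m + etaCauchy M a Λ ω m)) := by
  intro _
  simp [etaEvent_re, etaCauchy_re]
  have hκ₀ : 0 < surfaceGravity M a Λ (rMinus M a Λ) := lt_of_lt_of_le hκ₁ hle
  have h1 : ω.im / (2 * surfaceGravity M a Λ (rMinus M a Λ)) ≤
      ω.im / (2 * surfaceGravity M a Λ (rPlus M a Λ)) := by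
    apply div_le_div_of_nonneg_left hω (by positivity)
    linarith
  linarith

/-! ### Consequences used by box certificates -/

/-- **Finite reduction in `ω`, threshold rays included.** Under the fact, a non-trivial
generic-boundary mode with `Im ω > 0`, `Im(λ̄ ω̄) ≤ 0` and Prop. 3.8's conditions has
`0 < |ω| < |m|·Ω_SR`. [cite: CasalsTeixeiradacosta2022, Theorem 3.10 (proof) with Proposition 3.8 (arXiv v2)] -/
theorem CasalsTeixeiraDaCosta2022_partialModeStabilityProp38.window
    (h : CasalsTeixeiraDaCosta2022_partialModeStabilityProp38) {M a Λ s : ℝ} {ω : ℂ} {m : ℝ}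
    {lam : ℂ} (hsub : IsSubextremal M a Λ) (ha : 0 ≤ a) (haL : |a| < 3 / Λ)
    (hs : ∃ k : ℤ, 2 * s = k) (hm : ∃ k : ℤ, m - s = k) (hω : 0 < ω.im)
    (hlam : (lambdaBar a Λ s ω m lam * (starRingEnd ℂ) ω).im ≤ 0)
    (hsum : ∀ n : ℤ, 2 ≤ n → 2 * (etaCosmo M a Λ ω m - etaEvent M a Λ ω m) ≠ (n : ℂ))
    (p1 : PairCondition ((s : ℂ) - 2 * etaEvent M a Λ ω m))
    (p2 : PairCondition (-(s : ℂ) + 2 * etaCosmo M a Λ ω m))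
    (p3 : PairCondition (-2 * (etaEvent M a Λ ω m + etaCauchy M a Λ ω m)))
    (p4 : PairCondition (2 * (etaCauchy M a Λ ω m + etaCosmo M a Λ ω m))) {R : ℝ → ℂ}
    (hR : IsRadialTeukolskySolution M a Λ s ω m lam R) (hin : IsIngoingAtEventHorizon M a Λ s ω m R)
    (hout : IsOutgoingAtCosmoHorizon M a Λ ω m R)
    (hnt : ∃ r ∈ Ioo (rPlus M a Λ) (rCosmo M a Λ), R r ≠ 0) :
    0 < ‖ω‖ ∧ ‖ω‖ < |m| * superradiantUpper M a Λ := by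
  by_contra hw
  obtain ⟨r, hr, hne⟩ := hnt
  exact hne (h M a Λ s ω m lam hsub ha haL hs hm hω hlam hw hsum p1 p2 p3 p4 R hR hin hout r hr)

/-- **The `s = −2` threshold ray at the cosmological horizon** (the case a pub-kds box certificate
needs): on `Re ω = mϖ₂` with `Im ω > κ₂`, `κ₁ ≤ κ₀` and all `κ_j > 0`, every hypothesis of
Prop. 3.8 for the two quadruples holds, so a non-trivial generic-boundary `s = −2` mode there with
`Im(λ̄ ω̄) ≤ 0` has `|ω| < |m|·Ω_SR`. [cite: CasalsTeixeiradacosta2022, Theorem 3.10 (proof) with Proposition 3.8 (arXiv v2)] -/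
theorem CasalsTeixeiraDaCosta2022_partialModeStabilityProp38.cosmoRay_negTwo
    (h : CasalsTeixeiraDaCosta2022_partialModeStabilityProp38) {M a Λ : ℝ} {ω : ℂ} {m : ℝ}
    {lam : ℂ} (hsub : IsSubextremal M a Λ) (ha : 0 ≤ a) (haL : |a| < 3 / Λ) (hm : ∃ k : ℤ, m + 2 = k)
    (hκ₀ : 0 < surfaceGravity M a Λ (rMinus M a Λ)) (hκ₁ : 0 < surfaceGravity M a Λ (rPlus M a Λ))
    (hκ₂ : 0 < surfaceGravity M a Λ (rCosmo M a Λ))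
    (hle : surfaceGravity M a Λ (rPlus M a Λ) ≤ surfaceGravity M a Λ (rMinus M a Λ))
    (hre : ω.re = m * horizonAngVel a (rCosmo M a Λ))
    (hray : surfaceGravity M a Λ (rCosmo M a Λ) < ω.im)
    (hlam : (lambdaBar a Λ (-2) ω m lam * (starRingEnd ℂ) ω).im ≤ 0) {R : ℝ → ℂ}
    (hR : IsRadialTeukolskySolution M a Λ (-2) ω m lam R)
    (hin : IsIngoingAtEventHorizon M a Λ (-2) ω m R) (hout : IsOutgoingAtCosmoHorizon M a Λ ω m R)
    (hnt : ∃ r ∈ Ioo (rPlus M a Λ) (rCosmo M a Λ), R r ≠ 0) :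
    0 < ‖ω‖ ∧ ‖ω‖ < |m| * superradiantUpper M a Λ := by
  have hω : 0 < ω.im := lt_trans hκ₂ hray
  refine h.window hsub ha haL ⟨-4, by norm_num⟩ ?_ hω hlam (sum_ne_int hκ₁ hκ₂ hω) ?_ ?_
    (pairCondition_eventCauchy hκ₁ hle hω.le) (pairCondition_cauchyCosmo hκ₀ hκ₂ hω.le) hR hin hout hnt
  · obtain ⟨k, hk⟩ := hm
    exact ⟨k, by linarith⟩
  · by_cases hre1 : ω.re = m * horizonAngVel a (rPlus M a Λ)
    · rw [pairCondition_event_iff hκ₁ hre1]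
      have : ((-2 : ℝ) - 1) * surfaceGravity M a Λ (rPlus M a Λ) < 0 := by nlinarith
      linarith
    · exact pairCondition_event_of_re_ne hκ₁.ne' hre1
  · rw [pairCondition_cosmo_iff hκ₂ hre]
    linarith

end Literature.Geometry.Lorentzian.KerrDeSitter

end
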